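import Mathlib
import Summits.Ventures.HodgeRepro2.Defs
import Summits.Ventures.HodgeRepro2.BridgeCore

/-!
# BridgeFace — the Hodge-type bookkeeping of the quadruple period on p1's rank-four faces (Tier 4)

Seat p4 of the blind cell pub-hodge-repro2 (README §6, T4-A). This file connects the abstract type
bookkeeping of `BridgeCore` (§5 there) with p1's landed notion of a rank-four face
`IsWeilFace K T` (Defs.lean: four CM types, every embedding in exactly two of them — Deligne's balance),
read-only:

* `isType_two_two_of_isWeilFace`: at every embedding `φ`, the product of the four pulled-back
  eigen-one-forms (holomorphic at the vertices `i` with `φ ∈ T i`, antiholomorphic at the others) is a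
  class of pure type `(2, 2)` — the type condition for the eigen-period `a_φ = ∫_S ∏ᵢ fᵢ^* ηᵢ` not to
  vanish identically (TIER3 §6 item 16 (α));
* `nat_card_eq_two_of_integral_ne_zero`: conversely, if the eigen-period at `φ` is non-zero then `φ`
  lies in exactly two of the four CM types — balance at `φ` is necessary, vertex by vertex;
* `isType_one_one_of_isCMType`: for a CM type `Φ` and its conjugate `Φ̄`, the two eigenforms at `φ`
  have opposite types, so their product is a `(1, 1)`-class (item 16 (β): the Weil classes of a
  conjugate-pair face are products of divisor classes).
-/

namespace Summit.Ventures.HodgeRepro2.BridgeFace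

open Summit.Ventures.HodgeRepro2 Summit.Ventures.HodgeRepro2.BridgeCore

variable {K : Type*} [Field K]

/-- The holomorphic bit of vertex `i` at the embedding `φ`: `true` iff `φ ∈ T i` (the `φ`-eigenline of
`H¹(A_{T i}, ℂ)` is of type `(1, 0)` iff `φ` belongs to the CM type `T i`). -/
noncomputable def holBit (T : Fin 4 → Set (K →+* ℂ)) (φ : K →+* ℂ) (i : Fin 4) : Bool :=
  @decide (φ ∈ T i) (Classical.dec _)

/-- `holBit T φ i = true ↔ φ ∈ T i`. -/
theorem holBit_eq_true_iff (T : Fin 4 → Set (K →+* ℂ)) (φ : K →+* ℂ) (i : Fin 4) :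
    holBit T φ i = true ↔ φ ∈ T i := by
  unfold holBit
  exact @decide_eq_true_iff (φ ∈ T i) (Classical.dec _)

/-- `holBit T φ i = false ↔ φ ∉ T i`. -/
theorem holBit_eq_false_iff (T : Fin 4 → Set (K →+* ℂ)) (φ : K →+* ℂ) (i : Fin 4) :
    holBit T φ i = false ↔ φ ∉ T i := by
  rw [← Bool.not_eq_true, holBit_eq_true_iff]

open scoped Classical in
/-- Balance, as a `Finset` count: on a rank-four face exactly two vertices are holomorphic at `φ`. -/
theorem card_filter_holBit_true {T : Fin 4 → Set (K →+* ℂ)} (h : IsWeilFace K T)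
    (φ : K →+* ℂ) : (Finset.univ.filter fun i => holBit T φ i = true).card = 2 := by
  have h2 := h.2 φ
  rw [Nat.card_eq_fintype_card, Fintype.card_subtype] at h2
  rw [← h2]
  congr 1
  ext i
  simp [holBit_eq_true_iff]

/-- Balance, complementary count: exactly two vertices are antiholomorphic at `φ`. -/
theorem card_filter_holBit_false {T : Fin 4 → Set (K →+* ℂ)} (h : IsWeilFace K T)
    (φ : K →+* ℂ) : (Finset.univ.filter fun i => holBit T φ i = false).card = 2 := by
  have htot := Finset.card_filter_add_card_filter_not
    (s := (Finset.univ : Finset (Fin 4))) (p := fun i => holBit T φ i = true)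
  rw [card_filter_holBit_true h φ, Finset.card_univ, Fintype.card_fin] at htot
  have heq : (Finset.univ.filter fun i => holBit T φ i = false) =
      (Finset.univ.filter fun i => ¬ holBit T φ i = true) := by
    ext i
    simp [Bool.not_eq_true]
  rw [heq]
  omega

/-- **Balance gives the type `(2,2)`.** On a rank-four face, at every embedding `φ`, the product of
the four eigen-one-forms (of type `(1,0)` at the vertices containing `φ`, `(0,1)` at the others) is
of pure type `(2, 2)`. -/
theorem isType_two_two_of_isWeilFace {H : Type*} [CommRing H] (B : Bigrading H)
    {T : Fin 4 → Set (K →+* ℂ)} (h : IsWeilFace K T) (φ : K →+* ℂ) (η : Fin 4 → H)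
    (hη : ∀ i, B.IsType (Bigrading.oneFormType (holBit T φ i)).1
      (Bigrading.oneFormType (holBit T φ i)).2 (η i)) :
    B.IsType 2 2 (∏ i, η i) :=
  B.isType_prod_of_card_eq η (holBit T φ) hη (card_filter_holBit_true h φ)
    (card_filter_holBit_false h φ)

open scoped Classical in
/-- **Non-vanishing forces balance at `φ`.** If a functional supported in type `(2,2)` (the integral
over the surface) does not kill the product of the four eigen-one-forms at `φ`, then `φ` lies in
exactly two of the four CM types. -/
theorem nat_card_eq_two_of_integral_ne_zero {H : Type*} [CommRing H] {B : Bigrading H}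
    (I : Integral B 2 2) (T : Fin 4 → Set (K →+* ℂ)) (φ : K →+* ℂ) (η : Fin 4 → H)
    (hη : ∀ i, B.IsType (Bigrading.oneFormType (holBit T φ i)).1
      (Bigrading.oneFormType (holBit T φ i)).2 (η i))
    (hne : I.integral (∏ i, η i) ≠ 0) :
    Nat.card {i : Fin 4 // φ ∈ T i} = 2 := by
  have hc := (B.card_eq_of_integral_ne_zero I η (holBit T φ) hη hne).1
  rw [Nat.card_eq_fintype_card, Fintype.card_subtype, ← hc]
  congr 1
  ext i
  simp [holBit_eq_true_iff]

/-- A CM type and its conjugate have opposite holomorphic bits at every embedding. -/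
theorem decide_mem_ne_decide_mem_conjCMType {Φ : Set (K →+* ℂ)} (hΦ : IsCMType K Φ)
    (φ : K →+* ℂ) [Decidable (φ ∈ Φ)] [Decidable (φ ∈ conjCMType K Φ)] :
    decide (φ ∈ Φ) ≠ decide (φ ∈ conjCMType K Φ) := by
  have hx := hΦ φ
  have hconj : φ ∈ conjCMType K Φ ↔ NumberField.ComplexEmbedding.conjugate φ ∈ Φ := Iff.rfl
  intro heq
  rw [Bool.eq_iff_iff, decide_eq_true_iff, decide_eq_true_iff, hconj] at heq
  rcases hx with ⟨h1, h2⟩ | ⟨h1, h2⟩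
  · exact h2 (heq.1 h1)
  · exact h2 (heq.2 h1)

/-- **A conjugate pair of vertices gives a `(1,1)`-class** (item 16 (β)): at every embedding `φ`, the
eigenform of `A_Φ` and the eigenform of `A_{Φ̄}` have opposite types, so their product is of type
`(1,1)` — a divisor-type class. -/
theorem isType_one_one_of_isCMType {H : Type*} [CommRing H] (B : Bigrading H)
    {Φ : Set (K →+* ℂ)} (hΦ : IsCMType K Φ) (φ : K →+* ℂ)
    [Decidable (φ ∈ Φ)] [Decidable (φ ∈ conjCMType K Φ)] {x y : H}
    (hx : B.IsType (Bigrading.oneFormType (decide (φ ∈ Φ))).1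
      (Bigrading.oneFormType (decide (φ ∈ Φ))).2 x)
    (hy : B.IsType (Bigrading.oneFormType (decide (φ ∈ conjCMType K Φ))).1
      (Bigrading.oneFormType (decide (φ ∈ conjCMType K Φ))).2 y) :
    B.IsType 1 1 (x * y) :=
  B.isType_one_one_of_ne (decide_mem_ne_decide_mem_conjCMType hΦ φ) hx hy

end Summit.Ventures.HodgeRepro2.BridgeFace
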